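import Summits.CriticalPhenomena.PercolationContinuityZ3.Theorems.Transplant.FKConnectivityAllQAntipodalAndGenWeightParallel
import Summits.CriticalPhenomena.PercolationContinuityZ3.Theorems.Transplant.FKConnectivityAllQAntipodalAndGenWeightSides
import Summits.CriticalPhenomena.PercolationContinuityZ3.Theorems.Transplant.FKConnectivityAllQAntipodalAndGenPath
import HarnessLib

/-!
# Connectivity correlation inequalities for `φ_{w,q}`, every `q > 0` — file 32cW: the MASTER AND-DRIFT THEOREM FOR EVERY ANTITONE LEVEL
# WEIGHT (gen 17's Conjecture AND⁺ = the `q`-free level form of `C_∞` for the AND type)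

Support file (`--supports stmt-CriticalPhenomena-4575`), FK sub-lane `prim-bschramm-fk-2` (gen 21); builds on p205010 (kernel theorem,
internal audit signed; external expert review pending).  No definitions, no named facts, no sorries; standard axioms.

**`FK.andGenW_drift_nonpos_of_isTTSP`**: for every two-terminal series–parallel `E` between `s, t` with `st ∉ E`, all `N ⊆ E` (free), `A ⊆ E`
(attached on the root side), `C ⊆ A` (contracted), `N` disjoint from `A`, every ANTITONE weight `w : ℕ → ℝ` and every `h` monotone on the
subsets of `N`:
`∑_{γ ⊆ N} (w(k(γ∪A∪st)+k((N\γ)∪C)) − w(k((N\γ)∪A∪st)+k(γ∪C))) h(γ) ≤ 0`.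
This is gen 19's `FK.andGen_drift_nonpos_of_isTTSP` (`w = q^·`, `0 < q ≤ 1`) re-run with weights: the same strong induction on `|E|`
(rootless drifts by Duffin re-rooting `IsTTSP.reroot_erase`, virtual roots by the doubled-root lemma, series and parallel junctions), with the
weighted steps `FK.andGenW_series_nonpos`, `FK.andGenW_parallel_nonpos` (files 32W, 32aW) and `FK.andGenW_doubled` (file 32bW).  With
`w = 1_{· ≤ J}` it says that every LEVEL PARTIAL SUM of the AND-drift is `≤ 0`, i.e. the AND-drift polynomial divided by `q − 1` has nonnegative
coefficients — gen 17's Conjecture AND⁺ (FK-Q2 §26) — and, through the Abel bridge of `…AntipodalQfree.lean`, it re-proves the master AND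
theorem for all `0 ≤ q ≤ 1`.  The sibling `…AntipodalAndPlus.lean` states the consequences for `apPsiC` (every cell) — Conjecture C_∞⁺ of
gen 21 (memo FROM-fk-2-g21-QFREE, FK-Q2 §30) for the AND type.
[cite: Grimmett2006, §1.4 eq. (1.20) (p. 15); §3.8 Thm. (3.90) (pp. 61–62); §3.9 (pp. 63–64)] [cite: Wagner2006, Thm. 5.8(d), §5.3]
-/

noncomputable section

namespace Summit.CriticalPhenomena.PercolationContinuityZ3.Theorems

namespace FK

open SimpleGraph Literature.Probability.LatticeModels Literature.Probability.Percolation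
open scoped Classical

variable {V : Type*} [Fintype V]

section GenPathW

/-- **THE MASTER AND-DRIFT THEOREM FOR ANTITONE LEVEL WEIGHTS** (strong induction on the size of the network; see the module docstring).
[cite: Grimmett2006, §3.8 Thm. (3.90) (pp. 61–62); §3.9 (pp. 63–64)] [cite: Wagner2006, Thm. 5.8(d), §5.3] -/
theorem andGenW_drift_nonpos_of_isTTSP :
    ∀ (n : ℕ) {E : Finset (Sym2 V)} {s t : V} {N A C : Finset (Sym2 V)}, E.card ≤ n → IsTTSP E s t → s(s, t) ∉ E →
      N ⊆ E → A ⊆ E → C ⊆ A → Disjoint N A →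
      ∀ w : ℕ → ℝ, (∀ k : ℕ, w (k + 1) ≤ w k) →
      ∀ h : Finset (Sym2 V) → ℝ, (∀ ⦃X Y : Finset (Sym2 V)⦄, X ⊆ Y → Y ⊆ N → h X ≤ h Y) →
        ∑ γ ∈ N.powerset,
          (w (clusterCount (↑(insert s(s, t) (γ ∪ A)) : BondConfig V) ∅ + clusterCount (↑(N \ γ ∪ C) : BondConfig V) ∅) -
            w (clusterCount (↑(insert s(s, t) (N \ γ ∪ A)) : BondConfig V) ∅ + clusterCount (↑(γ ∪ C) : BondConfig V) ∅)) * h γ ≤ 0 := by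
  intro n
  induction n with
  | zero =>
    intro E s t N A C hcard hE _ _ _ _ _ _ _ _ _
    rw [Nat.le_zero, Finset.card_eq_zero] at hcard
    obtain ⟨e, he, _⟩ := hE.left_mem
    rw [hcard] at he
    exact absurd he (Finset.notMem_empty _)
  | succ n ih =>
    -- (R) the ROOTLESS weighted drift of a network of size `≤ n`
    have rootless : ∀ {F : Finset (Sym2 V)} {u v : V} {N A C : Finset (Sym2 V)}, F.card ≤ n → IsTTSP F u v →
        N ⊆ F → A ⊆ insert s(u, v) F → C ⊆ A → Disjoint N A →
        ∀ w : ℕ → ℝ, (∀ k : ℕ, w (k + 1) ≤ w k) →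
        ∀ h : Finset (Sym2 V) → ℝ, (∀ ⦃X Y : Finset (Sym2 V)⦄, X ⊆ Y → Y ⊆ N → h X ≤ h Y) →
          ∑ γ ∈ N.powerset,
            (w (clusterCount (↑(γ ∪ A) : BondConfig V) ∅ + clusterCount (↑(N \ γ ∪ C) : BondConfig V) ∅) -
              w (clusterCount (↑(N \ γ ∪ A) : BondConfig V) ∅ + clusterCount (↑(γ ∪ C) : BondConfig V) ∅)) * h γ ≤ 0 := by
      intro F u v N A C hF hFT hN hA hCA hNA w hw h hm
      by_cases hAC : A = C
      · subst hAC; exact (andGenW_rootless_self w N A h).le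
      · obtain ⟨e, he⟩ : (A \ C).Nonempty := by
          rw [Finset.nonempty_iff_ne_empty, Ne, Finset.sdiff_eq_empty_iff_subset]
          exact fun hh => hAC (le_antisymm hh hCA)
        revert he
        refine Sym2.ind (fun x y => ?_) e
        intro he
        have hxA : s(x, y) ∈ A := (Finset.mem_sdiff.1 he).1
        have hxC : s(x, y) ∉ C := (Finset.mem_sdiff.1 he).2
        by_cases hN0 : N = ∅
        · subst hN0; exact (andGenW_rootless_sum_empty w A C h).le
        · have hxF : s(x, y) ∈ insert s(u, v) F := hA hxA
          have hne : insert s(u, v) F ≠ {s(x, y)} := by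
            intro hh
            obtain ⟨f, hf⟩ := Finset.nonempty_iff_ne_empty.2 hN0
            have hf' : f ∈ ({s(x, y)} : Finset (Sym2 V)) := hh ▸ Finset.mem_insert_of_mem (hN hf)
            rw [Finset.mem_singleton] at hf'
            exact Finset.disjoint_left.1 hNA hf (hf' ▸ hxA)
          have hE' : IsTTSP ((insert s(u, v) F).erase s(x, y)) x y := hFT.reroot_erase hxF hne
          have hcard' : ((insert s(u, v) F).erase s(x, y)).card ≤ n := by
            have h1 := Finset.card_erase_of_mem hxF
            have h2 := Finset.card_insert_le s(u, v) F
            have h3 := Finset.card_pos.2 ⟨s(x, y), hxF⟩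
            omega
          have key := ih hcard' hE' (Finset.notMem_erase _ _) (N := N) (A := A.erase s(x, y)) (C := C)
            (fun f hf => Finset.mem_erase.2 ⟨fun hh => Finset.disjoint_left.1 hNA hf (hh ▸ hxA), Finset.mem_insert_of_mem (hN hf)⟩)
            (fun f hf => Finset.mem_erase.2 ⟨(Finset.mem_erase.1 hf).1, hA (Finset.mem_of_mem_erase hf)⟩)
            (fun f hf => Finset.mem_erase.2 ⟨fun hh => hxC (hh ▸ hf), hCA hf⟩)
            (Finset.disjoint_of_subset_right (Finset.erase_subset _ _) hNA) w hw h hm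
          have hins : ∀ X : Finset (Sym2 V), insert s(x, y) (X ∪ A.erase s(x, y)) = X ∪ A := fun X => by
            rw [← Finset.union_insert, Finset.insert_erase hxA]
          simp_rw [hins] at key
          exact key
    -- (V) the weighted drift with a VIRTUAL root `uv` (possibly an edge of the network) of a network of size `≤ n`
    have virt : ∀ {F : Finset (Sym2 V)} {u v : V} {N A C : Finset (Sym2 V)}, F.card ≤ n → IsTTSP F u v →
        N ⊆ F → A ⊆ F → C ⊆ A → Disjoint N A →
        ∀ w : ℕ → ℝ, (∀ k : ℕ, w (k + 1) ≤ w k) →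
        ∀ h : Finset (Sym2 V) → ℝ, (∀ ⦃X Y : Finset (Sym2 V)⦄, X ⊆ Y → Y ⊆ N → h X ≤ h Y) →
          ∑ γ ∈ N.powerset,
            (w (clusterCount (↑(insert s(u, v) (γ ∪ A)) : BondConfig V) ∅ + clusterCount (↑(N \ γ ∪ C) : BondConfig V) ∅) -
              w (clusterCount (↑(insert s(u, v) (N \ γ ∪ A)) : BondConfig V) ∅ + clusterCount (↑(γ ∪ C) : BondConfig V) ∅)) *
              h γ ≤ 0 := by
      intro F u v N A C hF hFT hN hA hCA hNA w hw h hm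
      by_cases huvF : s(u, v) ∈ F
      swap
      · exact ih hF hFT huvF hN hA hCA hNA w hw h hm
      by_cases huvA : s(u, v) ∈ A
      · have hins : ∀ X : Finset (Sym2 V), insert s(u, v) (X ∪ A) = X ∪ A := fun X =>
          Finset.insert_eq_of_mem (Finset.mem_union_right _ huvA)
        simp_rw [hins]
        exact rootless hF hFT hN (hA.trans (Finset.subset_insert _ _)) hCA hNA w hw h hm
      by_cases huvN : s(u, v) ∈ N
      · by_cases hF1 : F = {s(u, v)}
        · have hN' : N.erase s(u, v) = ∅ := Finset.eq_empty_of_forall_notMem fun f hf => by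
            have hfF := hN (Finset.mem_of_mem_erase hf)
            rw [hF1, Finset.mem_singleton] at hfF
            exact (Finset.mem_erase.1 hf).1 hfF
          refine andGenW_doubled hw huvN ?_ ?_ hm
          · intro h' _
            rw [hN']
            exact (andGenW_sum_empty w A C _ h').le
          · intro h' _
            rw [hN', Finset.powerset_empty, Finset.sum_singleton, Finset.empty_sdiff, Finset.empty_union, Finset.empty_union,
              sub_self, zero_mul]
        · have hE' : IsTTSP (F.erase s(u, v)) u v := hFT.erase_terminal_edge huvF hF1
          have hcard' : (F.erase s(u, v)).card ≤ n := (Finset.card_erase_le).trans hF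
          refine andGenW_doubled hw huvN ?_ ?_ hm
          · intro h' hm'
            exact ih hcard' hE' (Finset.notMem_erase _ _) (Finset.erase_subset_erase _ hN)
              (fun f hf => Finset.mem_erase.2 ⟨fun hh => huvA (hh ▸ hf), hA hf⟩) hCA
              (Finset.disjoint_of_subset_left (Finset.erase_subset _ _) hNA) w hw h' hm'
          · intro h' hm'
            have key := rootless hF hFT ((Finset.erase_subset _ _).trans hN) (A := insert s(u, v) A) (C := insert s(u, v) C)
              (Finset.insert_subset_insert _ hA) (Finset.insert_subset_insert _ hCA)
              (Finset.disjoint_insert_right.2 ⟨Finset.notMem_erase _ _,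
                Finset.disjoint_of_subset_left (Finset.erase_subset _ _) hNA⟩) w hw h' hm'
            simp_rw [Finset.union_insert] at key
            exact key
      · by_cases hF1 : F = {s(u, v)}
        · have hN' : N = ∅ := Finset.eq_empty_of_forall_notMem fun f hf => by
            have hfF := hN hf
            rw [hF1, Finset.mem_singleton] at hfF
            exact huvN (hfF ▸ hf)
          rw [hN']
          exact (andGenW_sum_empty w A C _ h).le
        · exact ih ((Finset.card_erase_le).trans hF) (hFT.erase_terminal_edge huvF hF1) (Finset.notMem_erase _ _)
            (fun f hf => Finset.mem_erase.2 ⟨fun hh => huvN (hh ▸ hf), hN hf⟩)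
            (fun f hf => Finset.mem_erase.2 ⟨fun hh => huvA (hh ▸ hf), hA hf⟩) hCA hNA w hw h hm
    -- the step: decompose `E` at its root
    intro E s t N A C hcard hE hst hN hA hCA hNA w hw h hmono
    cases hE with
    | edge hst' => exact absurd (Finset.mem_singleton_self _) hst
    | @series E₁ E₂ _ m _ h₁ h₂ hd hV hs' ht' =>
      have hNeq : N = N ∩ E₁ ∪ N ∩ E₂ := by rw [← Finset.inter_union_distrib_left, Finset.inter_eq_left.2 hN]
      have hAeq : A = A ∩ E₁ ∪ A ∩ E₂ := by rw [← Finset.inter_union_distrib_left, Finset.inter_eq_left.2 hA]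
      have hCeq : C = C ∩ E₁ ∪ C ∩ E₂ := by rw [← Finset.inter_union_distrib_left, Finset.inter_eq_left.2 (hCA.trans hA)]
      rw [hNeq] at hmono
      rw [hNeq, hAeq, hCeq]
      set V₁ : Set V := {z | ∃ e ∈ E₁, z ∈ e} with hV₁
      set V₂ : Set V := {z | ∃ e ∈ E₂, z ∈ e} with hV₂
      have g₁ : ∀ e ∈ (↑E₁ : Set (Sym2 V)), ∀ z ∈ e, z ∈ V₁ := fun e he z hz => ⟨e, he, hz⟩
      have g₂ : ∀ e ∈ (↑E₂ : Set (Sym2 V)), ∀ z ∈ e, z ∈ V₂ := fun e he z hz => ⟨e, he, hz⟩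
      have gS : V₁ ∩ V₂ ⊆ ({m} : Set V) := fun z hz => hV z hz.1 hz.2
      have hsV₂ : s ∉ V₂ := fun ⟨e, he, hse⟩ => hs' e he hse
      have htV₁ : t ∉ V₁ := fun ⟨e, he, hte⟩ => ht' e he hte
      have hsm : s ≠ m := h₁.ne
      have htm : t ≠ m := h₂.ne.symm
      have hstne : s ≠ t := by
        obtain ⟨e, he, hte⟩ := h₂.right_mem
        intro hh; exact hs' e he (hh ▸ hte)
      have hc := Finset.card_union_of_disjoint hd
      have hcard₁ : E₁.card ≤ n := by
        obtain ⟨e, he, _⟩ := h₂.left_mem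
        have h2pos : 0 < E₂.card := Finset.card_pos.2 ⟨e, he⟩
        omega
      have hcard₂ : E₂.card ≤ n := by
        obtain ⟨e, he, _⟩ := h₁.left_mem
        have h1pos : 0 < E₁.card := Finset.card_pos.2 ⟨e, he⟩
        omega
      have hd₁ : Disjoint (N ∩ E₁) (A ∩ E₁) :=
        Finset.disjoint_of_subset_left Finset.inter_subset_left (Finset.disjoint_of_subset_right Finset.inter_subset_left hNA)
      have hd₂ : Disjoint (N ∩ E₂) (A ∩ E₂) :=
        Finset.disjoint_of_subset_left Finset.inter_subset_left (Finset.disjoint_of_subset_right Finset.inter_subset_left hNA)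
      have hCA₁ : C ∩ E₁ ⊆ A ∩ E₁ := Finset.inter_subset_inter hCA le_rfl
      have hCA₂ : C ∩ E₂ ⊆ A ∩ E₂ := Finset.inter_subset_inter hCA le_rfl
      exact andGenW_series_nonpos g₁ g₂ gS hsV₂ htV₁ hsm htm hstne
        (Finset.disjoint_of_subset_left Finset.inter_subset_right (Finset.disjoint_of_subset_right Finset.inter_subset_right hd))
        Finset.inter_subset_right Finset.inter_subset_right Finset.inter_subset_right
        Finset.inter_subset_right Finset.inter_subset_right Finset.inter_subset_right
        (fun w' hw' h' hm' => virt hcard₁ h₁ Finset.inter_subset_right Finset.inter_subset_right hCA₁ hd₁ w' hw' h' hm')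
        (fun w' hw' h' hm' => rootless hcard₁ h₁ Finset.inter_subset_right (Finset.inter_subset_right.trans (Finset.subset_insert _ _))
          hCA₁ hd₁ w' hw' h' hm')
        (fun w' hw' h' hm' => virt hcard₂ h₂ Finset.inter_subset_right Finset.inter_subset_right hCA₂ hd₂ w' hw' h' hm')
        (fun w' hw' h' hm' => rootless hcard₂ h₂ Finset.inter_subset_right (Finset.inter_subset_right.trans (Finset.subset_insert _ _))
          hCA₂ hd₂ w' hw' h' hm') hw hmono
    | @parallel E₁ E₂ _ _ h₁ h₂ hd hV =>
      have hNeq : N = N ∩ E₁ ∪ N ∩ E₂ := by rw [← Finset.inter_union_distrib_left, Finset.inter_eq_left.2 hN]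
      have hAeq : A = A ∩ E₁ ∪ A ∩ E₂ := by rw [← Finset.inter_union_distrib_left, Finset.inter_eq_left.2 hA]
      have hCeq : C = C ∩ E₁ ∪ C ∩ E₂ := by rw [← Finset.inter_union_distrib_left, Finset.inter_eq_left.2 (hCA.trans hA)]
      rw [hNeq] at hmono
      rw [hNeq, hAeq, hCeq]
      set V₁ : Set V := {z | ∃ e ∈ E₁, z ∈ e} with hV₁
      set V₂ : Set V := {z | ∃ e ∈ E₂, z ∈ e} with hV₂
      have g₁ : ∀ e ∈ (↑E₁ : Set (Sym2 V)), ∀ z ∈ e, z ∈ V₁ := fun e he z hz => ⟨e, he, hz⟩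
      have g₂ : ∀ e ∈ (↑E₂ : Set (Sym2 V)), ∀ z ∈ e, z ∈ V₂ := fun e he z hz => ⟨e, he, hz⟩
      have gS : V₁ ∩ V₂ ⊆ ({s, t} : Set V) := by
        intro z hz
        rcases hV z hz.1 hz.2 with h' | h'
        · exact Or.inl h'
        · exact Or.inr h'
      have hstne : s ≠ t := h₁.ne
      have hst₁ : s(s, t) ∉ E₁ := fun h' => hst (Finset.mem_union_left _ h')
      have hst₂ : s(s, t) ∉ E₂ := fun h' => hst (Finset.mem_union_right _ h')
      have hc := Finset.card_union_of_disjoint hd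
      have hcard₁ : E₁.card ≤ n := by
        obtain ⟨e, he, _⟩ := h₂.left_mem
        have h2pos : 0 < E₂.card := Finset.card_pos.2 ⟨e, he⟩
        omega
      have hcard₂ : E₂.card ≤ n := by
        obtain ⟨e, he, _⟩ := h₁.left_mem
        have h1pos : 0 < E₁.card := Finset.card_pos.2 ⟨e, he⟩
        omega
      have hd₁ : Disjoint (N ∩ E₁) (A ∩ E₁) :=
        Finset.disjoint_of_subset_left Finset.inter_subset_left (Finset.disjoint_of_subset_right Finset.inter_subset_left hNA)
      have hd₂ : Disjoint (N ∩ E₂) (A ∩ E₂) :=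
        Finset.disjoint_of_subset_left Finset.inter_subset_left (Finset.disjoint_of_subset_right Finset.inter_subset_left hNA)
      have hCA₁ : C ∩ E₁ ⊆ A ∩ E₁ := Finset.inter_subset_inter hCA le_rfl
      have hCA₂ : C ∩ E₂ ⊆ A ∩ E₂ := Finset.inter_subset_inter hCA le_rfl
      refine andGenW_parallel_nonpos g₁ g₂ gS hstne
        (Finset.disjoint_of_subset_left Finset.inter_subset_right (Finset.disjoint_of_subset_right Finset.inter_subset_right hd))
        Finset.inter_subset_right Finset.inter_subset_right Finset.inter_subset_right
        Finset.inter_subset_right Finset.inter_subset_right Finset.inter_subset_right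
        (fun w' hw' h' hm' => ih hcard₁ h₁ hst₁ Finset.inter_subset_right Finset.inter_subset_right hCA₁ hd₁ w' hw' h' hm') ?_
        (fun w' hw' h' hm' => ih hcard₂ h₂ hst₂ Finset.inter_subset_right Finset.inter_subset_right hCA₂ hd₂ w' hw' h' hm') ?_ hw hmono
      · intro w' hw' h' hm'
        have key := rootless hcard₁ h₁ Finset.inter_subset_right (A := insert s(s, t) (A ∩ E₁)) (C := insert s(s, t) (C ∩ E₁))
          (Finset.insert_subset_insert _ Finset.inter_subset_right) (Finset.insert_subset_insert _ hCA₁)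
          (Finset.disjoint_insert_right.2 ⟨fun hh => hst₁ (Finset.inter_subset_right hh), hd₁⟩) w' hw' h' hm'
        simp_rw [Finset.union_insert] at key
        exact key
      · intro w' hw' h' hm'
        have key := rootless hcard₂ h₂ Finset.inter_subset_right (A := insert s(s, t) (A ∩ E₂)) (C := insert s(s, t) (C ∩ E₂))
          (Finset.insert_subset_insert _ Finset.inter_subset_right) (Finset.insert_subset_insert _ hCA₂)
          (Finset.disjoint_insert_right.2 ⟨fun hh => hst₂ (Finset.inter_subset_right hh), hd₂⟩) w' hw' h' hm'
        simp_rw [Finset.union_insert] at key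
        exact key

end GenPathW

end FK

end Summit.CriticalPhenomena.PercolationContinuityZ3.Theorems

end
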